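import Mathlib
import Literature.Dynamics.Contraction.ComplexConeContraction

/-!
# Row pairs of a matrix satisfying Dubois' aperture condition

Helper file for item stmt-CriticalPhenomena-8789 (`ComplexConeContraction`, route CardyComplexCone
of `CardyFormulaZ2`). For a rectangular complex matrix `A` satisfying Dubois' condition
`θ⁻¹ |a_kp a_lq − a_kq a_lp| < Re(conj(a_kp) a_lq + conj(a_kq) a_lp)` (`0 < θ < 1`, all rows `k, l`
and columns `p, q`) we study the sets `E_kl = E_{Int ℂⁿ₊}(λ_k, λ_l)` attached to two ROWS `λ_k, λ_l`
(Dubois 2009, proof of Prop. 3.3 and Thm. 3.6): by Lemma 3.2 (`duboisE_rughConeInt_eq_iUnion`,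
Literature) `E_kl` is the union of the closed discs `D̄_pq` of centre `c_pq` and radius `r_pq` given
by (3.21), the condition says exactly `r_pq < θ Re(c_pq)`, and `D̄_pq` passes through the two ratios
`a_lp / a_kp`, `a_lq / a_kq`. Chaining three such discs we obtain the uniform estimates
(`rowPair_chain`) `‖t − s‖ ≤ K Re(s)` and `Re(t) ≤ K Re(s)` for all `s, t ∈ E_kl`, with
`K = ((1+θ)/(1−θ))³` — an elementary substitute for the hyperbolic-diameter bound
`Δ₂ ≤ 3 log((1+θ)/(1−θ))` of Dubois' proof of Theorem 3.6. Finally, generic facts on the discs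
`D̄_kl(x,y)`: a closed disc inside the annulus `{a ≤ |z| ≤ b}`, `a > 0`, has diameter `≤ b − a`
(`norm_sub_le_of_closedBall_subset_annulus`), whence any two points of `E_{Int ℂⁿ₊}(x,y) ⊆
{a ≤ |z| ≤ b}` are within `3 (b − a)` (`norm_sub_le_three_mul`, a chain of three discs).

Reference: L. Dubois, *Projective metrics and contraction principles for complex cones*, J. London
Math. Soc. 79 (2009), §3.
-/

open scoped ComplexConjugate
open Metric Set

namespace Summit.CriticalPhenomena.CardyFormulaZ2.Theorems.ComplexConeContraction

open Literature.Dynamics.Contraction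

/-! ### Generic facts on Dubois' discs `D̄_kl(x,y)` -/

/-- The radius `r_kl(x,y)` is nonnegative when `Re(x_k conj x_l) > 0`. -/
theorem duboisRadius_nonneg {n : ℕ} (x y : Fin n → ℂ) (k l : Fin n)
    (hα : 0 < (x k * conj (x l)).re) : 0 ≤ duboisRadius x y k l :=
  div_nonneg (norm_nonneg _) (by linarith)

/-- The ratio `y_k / x_k` lies in the disc `D̄_kl(x,y)` (it is on its boundary circle). -/
theorem div_left_mem_closedBall {n : ℕ} (x y : Fin n → ℂ) (k l : Fin n)
    (hα : 0 < (x k * conj (x l)).re) :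
    y k / x k ∈ closedBall (duboisCenter x y k l) (duboisRadius x y k l) := by
  rw [← re_mul_conj_nonpos_iff_mem_closedBall x y k l hα]
  have hxk : x k ≠ 0 := fun h => by simp [h] at hα
  rw [div_mul_cancel₀ _ hxk, sub_self, map_zero, mul_zero, Complex.zero_re]

/-- The ratio `y_l / x_l` lies in the disc `D̄_kl(x,y)` (it is on its boundary circle). -/
theorem div_right_mem_closedBall {n : ℕ} (x y : Fin n → ℂ) (k l : Fin n)
    (hα : 0 < (x k * conj (x l)).re) :
    y l / x l ∈ closedBall (duboisCenter x y k l) (duboisRadius x y k l) := by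
  rw [← re_mul_conj_nonpos_iff_mem_closedBall x y k l hα]
  have hxl : x l ≠ 0 := fun h => by simp [h] at hα
  rw [div_mul_cancel₀ _ hxl, sub_self, zero_mul, Complex.zero_re]

/-- Real parts in a closed disc: `Re c − r ≤ Re z ≤ Re c + r`. -/
theorem re_mem_Icc_of_mem_closedBall {c z : ℂ} {r : ℝ} (hz : z ∈ closedBall c r) :
    c.re - r ≤ z.re ∧ z.re ≤ c.re + r := by
  rw [mem_closedBall, dist_eq_norm] at hz
  have h := Complex.abs_re_le_norm (z - c)
  rw [Complex.sub_re] at h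
  constructor <;> linarith [(abs_le.1 (h.trans hz)).1, (abs_le.1 (h.trans hz)).2]

/-- Two points of a closed disc are at distance at most `2r`. -/
theorem norm_sub_le_of_mem_closedBall {c z w : ℂ} {r : ℝ} (hz : z ∈ closedBall c r)
    (hw : w ∈ closedBall c r) : ‖z - w‖ ≤ 2 * r := by
  rw [mem_closedBall, dist_eq_norm] at hz hw
  calc ‖z - w‖ = ‖(z - c) - (w - c)‖ := by ring_nf
    _ ≤ ‖z - c‖ + ‖w - c‖ := norm_sub_le _ _
    _ ≤ 2 * r := by linarith

/-! ### Rows of a matrix satisfying Dubois' condition -/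

section Rows

variable {θ : ℝ} {m n : ℕ} {A : Matrix (Fin m) (Fin n) ℂ}

/-- Each row of a matrix satisfying Dubois' condition lies in `Int ℂⁿ₊` (take `k = l` in the
condition; Dubois 2009, end of the proof of Prop. 3.3). -/
theorem row_mem_rughConeInt (hθ : 0 < θ)
    (hA : ∀ k l p q, θ⁻¹ * ‖A k p * A l q - A k q * A l p‖ <
      (conj (A k p) * A l q + conj (A k q) * A l p).re)
    (k : Fin m) : A k ∈ rughConeInt n := by
  intro p q
  have h := hA k k p q
  have h0 : θ⁻¹ * ‖A k p * A k q - A k q * A k p‖ = 0 := by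
    rw [mul_comm (A k p), sub_self, norm_zero, mul_zero]
  rw [h0, Complex.add_re] at h
  have h1 : (conj (A k p) * A k q).re = (A k p * conj (A k q)).re := by
    simp only [Complex.mul_re, Complex.conj_re, Complex.conj_im]; ring
  have h2 : (conj (A k q) * A k p).re = (A k p * conj (A k q)).re := by
    simp only [Complex.mul_re, Complex.conj_re, Complex.conj_im]; ring
  have _ := hθ
  linarith

/-- Dubois' condition says that the disc `D̄_pq(λ_k, λ_l)` of (3.21) satisfies `r_pq < θ Re(c_pq)`
(Dubois 2009, proof of Prop. 3.3 / Thm. 3.6). -/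
theorem duboisRadius_lt_mul_re_center (hθ : 0 < θ)
    (hA : ∀ k l p q, θ⁻¹ * ‖A k p * A l q - A k q * A l p‖ <
      (conj (A k p) * A l q + conj (A k q) * A l p).re)
    (k l : Fin m) (p q : Fin n) :
    duboisRadius (A k) (A l) p q < θ * (duboisCenter (A k) (A l) p q).re := by
  have hD : 0 < (A k p * conj (A k q)).re := row_mem_rughConeInt hθ hA k p q
  have h := hA k l p q
  have h' : ‖A k q * A l p - A k p * A l q‖ <
      θ * (conj (A k q) * A l p + conj (A k p) * A l q).re := by
    rw [norm_sub_rev, add_comm]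
    have := mul_lt_mul_of_pos_left h hθ
    rwa [← mul_assoc, mul_inv_cancel₀ hθ.ne', one_mul] at this
  unfold duboisRadius duboisCenter
  rw [Complex.div_ofReal_re, mul_div_assoc']
  exact div_lt_div_of_pos_right h' (by linarith)

/-- The ratio `a_lp / a_kp` lies in the disc `D̄_pq(λ_k, λ_l)`. -/
theorem ratio_mem_closedBall_left (hθ : 0 < θ)
    (hA : ∀ k l p q, θ⁻¹ * ‖A k p * A l q - A k q * A l p‖ <
      (conj (A k p) * A l q + conj (A k q) * A l p).re)
    (k l : Fin m) (p q : Fin n) :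
    A l p / A k p ∈ closedBall (duboisCenter (A k) (A l) p q) (duboisRadius (A k) (A l) p q) :=
  div_left_mem_closedBall (A k) (A l) p q (row_mem_rughConeInt hθ hA k p q)

/-- The ratio `a_lq / a_kq` lies in the disc `D̄_pq(λ_k, λ_l)`. -/
theorem ratio_mem_closedBall_right (hθ : 0 < θ)
    (hA : ∀ k l p q, θ⁻¹ * ‖A k p * A l q - A k q * A l p‖ <
      (conj (A k p) * A l q + conj (A k q) * A l p).re)
    (k l : Fin m) (p q : Fin n) :
    A l q / A k q ∈ closedBall (duboisCenter (A k) (A l) p q) (duboisRadius (A k) (A l) p q) :=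
  div_right_mem_closedBall (A k) (A l) p q (row_mem_rughConeInt hθ hA k p q)

/-- Membership in `E_kl = E_{Int ℂⁿ₊}(λ_k, λ_l)` means membership in one of the discs `D̄_pq`. -/
theorem exists_mem_closedBall_of_mem_duboisE (hθ : 0 < θ)
    (hA : ∀ k l p q, θ⁻¹ * ‖A k p * A l q - A k q * A l p‖ <
      (conj (A k p) * A l q + conj (A k q) * A l p).re)
    (k l : Fin m) {s : ℂ} (hs : s ∈ duboisE (rughConeInt n) (A k) (A l)) :
    ∃ p q, s ∈ closedBall (duboisCenter (A k) (A l) p q) (duboisRadius (A k) (A l) p q) := by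
  rw [duboisE_rughConeInt_eq_iUnion (row_mem_rughConeInt hθ hA k)] at hs
  simpa only [mem_iUnion] using hs

/-- **Chain estimate for a row pair** (elementary form of `Δ₂ ≤ 3 log((1+θ)/(1−θ))` in Dubois' proof
of Theorem 3.6): for `s, t ∈ E_kl` one has `Re s > 0`, `‖t − s‖ ≤ K Re s` and `Re t ≤ K Re s` with
`K = ((1+θ)/(1−θ))³`. Proof: `s ∈ D̄_pq`, `t ∈ D̄_p'q'`, and the discs `D̄_pq ∋ a_lp/a_kp ∈ D̄_pp' ∋
a_lp'/a_kp' ∈ D̄_p'q'` form a chain of three discs each with `r < θ Re c`. -/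
theorem rowPair_chain (hθ : 0 < θ) (hθ1 : θ < 1)
    (hA : ∀ k l p q, θ⁻¹ * ‖A k p * A l q - A k q * A l p‖ <
      (conj (A k p) * A l q + conj (A k q) * A l p).re)
    (k l : Fin m) {s t : ℂ} (hs : s ∈ duboisE (rughConeInt n) (A k) (A l))
    (ht : t ∈ duboisE (rughConeInt n) (A k) (A l)) :
    0 < s.re ∧ ‖t - s‖ ≤ ((1 + θ) / (1 - θ)) ^ 3 * s.re ∧
      t.re ≤ ((1 + θ) / (1 - θ)) ^ 3 * s.re := by
  obtain ⟨p, q, hs⟩ := exists_mem_closedBall_of_mem_duboisE hθ hA k l hs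
  obtain ⟨p', q', ht⟩ := exists_mem_closedBall_of_mem_duboisE hθ hA k l ht
  -- the three discs of the chain and the two connecting ratios
  set c₁ := duboisCenter (A k) (A l) p q with hc₁
  set r₁ := duboisRadius (A k) (A l) p q with hr₁
  set c₂ := duboisCenter (A k) (A l) p p' with hc₂
  set r₂ := duboisRadius (A k) (A l) p p' with hr₂
  set c₃ := duboisCenter (A k) (A l) p' q' with hc₃
  set r₃ := duboisRadius (A k) (A l) p' q' with hr₃
  have hρ₁ : A l p / A k p ∈ closedBall c₁ r₁ := ratio_mem_closedBall_left hθ hA k l p q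
  have hρ₂ : A l p / A k p ∈ closedBall c₂ r₂ := ratio_mem_closedBall_left hθ hA k l p p'
  have hρ₂' : A l p' / A k p' ∈ closedBall c₂ r₂ := ratio_mem_closedBall_right hθ hA k l p p'
  have hρ₃ : A l p' / A k p' ∈ closedBall c₃ r₃ := ratio_mem_closedBall_left hθ hA k l p' q'
  have hcr₁ : r₁ < θ * c₁.re := duboisRadius_lt_mul_re_center hθ hA k l p q
  have hcr₂ : r₂ < θ * c₂.re := duboisRadius_lt_mul_re_center hθ hA k l p p'
  have hcr₃ : r₃ < θ * c₃.re := duboisRadius_lt_mul_re_center hθ hA k l p' q'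
  have hr₁0 : 0 ≤ r₁ := duboisRadius_nonneg _ _ _ _ (row_mem_rughConeInt hθ hA k p q)
  have hr₂0 : 0 ≤ r₂ := duboisRadius_nonneg _ _ _ _ (row_mem_rughConeInt hθ hA k p p')
  have hr₃0 : 0 ≤ r₃ := duboisRadius_nonneg _ _ _ _ (row_mem_rughConeInt hθ hA k p' q')
  -- real parts along the chain
  have hs_re := (re_mem_Icc_of_mem_closedBall hs).1
  have h12 := (re_mem_Icc_of_mem_closedBall hρ₁).2
  have h21 := (re_mem_Icc_of_mem_closedBall hρ₂).1
  have h22 := (re_mem_Icc_of_mem_closedBall hρ₂').2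
  have h31 := (re_mem_Icc_of_mem_closedBall hρ₃).1
  have ht_re := (re_mem_Icc_of_mem_closedBall ht).2
  -- distances along the chain
  have hd₁ : ‖A l p / A k p - s‖ ≤ 2 * r₁ := norm_sub_le_of_mem_closedBall hρ₁ hs
  have hd₂ : ‖A l p' / A k p' - A l p / A k p‖ ≤ 2 * r₂ := norm_sub_le_of_mem_closedBall hρ₂' hρ₂
  have hd₃ : ‖t - A l p' / A k p'‖ ≤ 2 * r₃ := norm_sub_le_of_mem_closedBall ht hρ₃
  have hts : ‖t - s‖ ≤ 2 * (r₁ + r₂ + r₃) := by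
    calc ‖t - s‖
          = ‖(t - A l p' / A k p') + (A l p' / A k p' - A l p / A k p) + (A l p / A k p - s)‖ := by
          ring_nf
      _ ≤ ‖t - A l p' / A k p'‖ + ‖A l p' / A k p' - A l p / A k p‖ + ‖A l p / A k p - s‖ :=
          norm_add₃_le
      _ ≤ 2 * (r₁ + r₂ + r₃) := by linarith
  have h1θ : 0 < 1 - θ := by linarith
  -- comparison of the three real parts with `Re s`
  have e₁ : (1 - θ) * c₁.re < s.re := by linarith
  have e₂ : (1 - θ) * c₂.re < (1 + θ) * c₁.re := by linarith
  have e₃ : (1 - θ) * c₃.re < (1 + θ) * c₂.re := by linarith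
  have hc₁0 : 0 < c₁.re := (mul_pos_iff_of_pos_left hθ).1 (lt_of_le_of_lt hr₁0 hcr₁)
  have hspos : 0 < s.re := by
    have := mul_pos h1θ hc₁0
    linarith
  have h1θ' : 0 < 1 + θ := by linarith
  have f₁ : (1 - θ) ^ 3 * c₁.re < (1 - θ) ^ 2 * s.re := by
    calc (1 - θ) ^ 3 * c₁.re = (1 - θ) ^ 2 * ((1 - θ) * c₁.re) := by ring
      _ < (1 - θ) ^ 2 * s.re := mul_lt_mul_of_pos_left e₁ (pow_pos h1θ 2)
  have f₂ : (1 - θ) ^ 3 * c₂.re < (1 + θ) * (1 - θ) * s.re := by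
    calc (1 - θ) ^ 3 * c₂.re = (1 - θ) ^ 2 * ((1 - θ) * c₂.re) := by ring
      _ < (1 - θ) ^ 2 * ((1 + θ) * c₁.re) := mul_lt_mul_of_pos_left e₂ (pow_pos h1θ 2)
      _ = (1 + θ) * (1 - θ) * ((1 - θ) * c₁.re) := by ring
      _ < (1 + θ) * (1 - θ) * s.re := mul_lt_mul_of_pos_left e₁ (mul_pos h1θ' h1θ)
  have f₃ : (1 - θ) ^ 3 * c₃.re < (1 + θ) ^ 2 * s.re := by
    calc (1 - θ) ^ 3 * c₃.re = (1 - θ) ^ 2 * ((1 - θ) * c₃.re) := by ring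
      _ < (1 - θ) ^ 2 * ((1 + θ) * c₂.re) := mul_lt_mul_of_pos_left e₃ (pow_pos h1θ 2)
      _ = (1 + θ) * (1 - θ) * ((1 - θ) * c₂.re) := by ring
      _ < (1 + θ) * (1 - θ) * ((1 + θ) * c₁.re) :=
          mul_lt_mul_of_pos_left e₂ (mul_pos h1θ' h1θ)
      _ = (1 + θ) ^ 2 * ((1 - θ) * c₁.re) := by ring
      _ < (1 + θ) ^ 2 * s.re := mul_lt_mul_of_pos_left e₁ (pow_pos h1θ' 2)
  -- summing up: `2θ (1-θ)³ (R₁+R₂+R₃) < 2θ (3 + θ²) Re s = ((1+θ)³ - (1-θ)³) Re s`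
  have hsum : (1 - θ) ^ 3 * (2 * (r₁ + r₂ + r₃)) < ((1 + θ) ^ 3 - (1 - θ) ^ 3) * s.re := by
    have g : r₁ + r₂ + r₃ < θ * (c₁.re + c₂.re + c₃.re) := by linarith
    have g' : (1 - θ) ^ 3 * (2 * (r₁ + r₂ + r₃)) <
        (1 - θ) ^ 3 * (2 * (θ * (c₁.re + c₂.re + c₃.re))) :=
      mul_lt_mul_of_pos_left (by linarith) (pow_pos h1θ 3)
    have g'' : θ * ((1 - θ) ^ 3 * (c₁.re + c₂.re + c₃.re)) < θ * ((3 + θ ^ 2) * s.re) :=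
      mul_lt_mul_of_pos_left (by linarith) hθ
    nlinarith
  have hK : ((1 + θ) / (1 - θ)) ^ 3 * s.re = (1 + θ) ^ 3 * s.re / (1 - θ) ^ 3 := by
    rw [div_pow]; ring
  have hpow : 0 < (1 - θ) ^ 3 := pow_pos h1θ 3
  refine ⟨hspos, ?_, ?_⟩
  · rw [hK, le_div_iff₀ hpow]
    have g : ‖t - s‖ * (1 - θ) ^ 3 ≤ (1 - θ) ^ 3 * (2 * (r₁ + r₂ + r₃)) := by
      rw [mul_comm]; exact mul_le_mul_of_nonneg_left hts hpow.le
    have g' : ((1 + θ) ^ 3 - (1 - θ) ^ 3) * s.re ≤ (1 + θ) ^ 3 * s.re := by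
      have := mul_pos hpow hspos
      linarith
    linarith
  · rw [hK, le_div_iff₀ hpow]
    have g : t.re < (1 + θ) * c₃.re := by linarith
    calc t.re * (1 - θ) ^ 3 ≤ ((1 + θ) * c₃.re) * (1 - θ) ^ 3 := (mul_lt_mul_of_pos_right g hpow).le
      _ = (1 + θ) * ((1 - θ) ^ 3 * c₃.re) := by ring
      _ ≤ (1 + θ) * ((1 + θ) ^ 2 * s.re) := mul_le_mul_of_nonneg_left f₃.le h1θ'.le
      _ = (1 + θ) ^ 3 * s.re := by ring

end Rows

/-! ### Discs inside an annulus; any two points of `E(x,y)` are `3(b-a)`-close -/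

/-- A closed disc of `ℂ` contained in the annulus `{a ≤ |z| ≤ b}` with `a > 0` has diameter at most
`b − a` (its radial extent is `2r`). -/
theorem norm_sub_le_of_closedBall_subset_annulus {c : ℂ} {r a b : ℝ} (ha : 0 < a) (hr : 0 ≤ r)
    (h : ∀ z ∈ closedBall c r, a ≤ ‖z‖ ∧ ‖z‖ ≤ b) {z w : ℂ} (hz : z ∈ closedBall c r)
    (hw : w ∈ closedBall c r) : ‖z - w‖ ≤ b - a := by
  have hc : c ≠ 0 := by
    intro hc
    have := (h 0 (by simp [hc, hr])).1
    simp at this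
    linarith
  have hcn : 0 < ‖c‖ := norm_pos_iff.2 hc
  -- if `r > ‖c‖` the disc contains `0`, impossible
  have hrc : r ≤ ‖c‖ := by
    by_contra hlt
    have h0 : (0 : ℂ) ∈ closedBall c r := by
      rw [mem_closedBall, dist_eq_norm, zero_sub, norm_neg]
      linarith [not_le.1 hlt]
    have := (h 0 h0).1
    simp at this
    linarith
  -- the two radially extreme points `c ± (r/‖c‖) c`
  set e : ℂ := ((r / ‖c‖ : ℝ) : ℂ) * c with he_def
  have he : ‖e‖ = r := by
    rw [he_def, norm_mul, Complex.norm_real, Real.norm_eq_abs,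
      abs_of_nonneg (div_nonneg hr hcn.le), div_mul_cancel₀ _ hcn.ne']
  have h1 : c + e ∈ closedBall c r := by
    rw [mem_closedBall, dist_eq_norm, add_sub_cancel_left, he]
  have h2 : c - e ∈ closedBall c r := by
    rw [mem_closedBall, dist_eq_norm, sub_sub_cancel_left, norm_neg, he]
  have hn1 : ‖c + e‖ = ‖c‖ + r := by
    have : c + e = ((1 + r / ‖c‖ : ℝ) : ℂ) * c := by rw [he_def]; push_cast; ring
    rw [this, norm_mul, Complex.norm_real, Real.norm_eq_abs, abs_of_nonneg (by positivity), add_mul,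
      one_mul, div_mul_cancel₀ _ hcn.ne']
  have hn2 : ‖c - e‖ = ‖c‖ - r := by
    have : c - e = ((1 - r / ‖c‖ : ℝ) : ℂ) * c := by rw [he_def]; push_cast; ring
    have hnn : 0 ≤ 1 - r / ‖c‖ := by rw [sub_nonneg, div_le_one hcn]; exact hrc
    rw [this, norm_mul, Complex.norm_real, Real.norm_eq_abs, abs_of_nonneg hnn, sub_mul, one_mul,
      div_mul_cancel₀ _ hcn.ne']
  have hb := (h _ h1).2
  have ha' := (h _ h2).1
  rw [hn1] at hb
  rw [hn2] at ha'
  rw [mem_closedBall, dist_eq_norm] at hz hw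
  calc ‖z - w‖ = ‖(z - c) - (w - c)‖ := by ring_nf
    _ ≤ ‖z - c‖ + ‖w - c‖ := norm_sub_le _ _
    _ ≤ b - a := by linarith

/-- Any two points of `E_{Int ℂⁿ₊}(x,y) ⊆ {a ≤ |z| ≤ b}` (`x ∈ Int ℂⁿ₊`, `a > 0`) are within
`3 (b − a)`: `z ∈ D̄_{k₁l₁} ∋ y_{k₁}/x_{k₁} ∈ D̄_{k₁k₂} ∋ y_{k₂}/x_{k₂} ∈ D̄_{k₂l₂} ∋ w` and each
disc has diameter `≤ b − a` (Dubois 2009, Lemma 3.2; cf. the proof of Lemma 5.4). -/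
theorem norm_sub_le_three_mul {n : ℕ} {x y : Fin n → ℂ} (hx : x ∈ rughConeInt n) {a b : ℝ}
    (ha : 0 < a) (hE : ∀ z ∈ duboisE (rughConeInt n) x y, a ≤ ‖z‖ ∧ ‖z‖ ≤ b) {z w : ℂ}
    (hz : z ∈ duboisE (rughConeInt n) x y) (hw : w ∈ duboisE (rughConeInt n) x y) :
    ‖z - w‖ ≤ 3 * (b - a) := by
  have hU := duboisE_rughConeInt_eq_iUnion hx y
  have hz' := hz
  have hw' := hw
  rw [hU] at hz' hw'
  simp only [mem_iUnion] at hz' hw'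
  obtain ⟨k₁, l₁, hz₁⟩ := hz'
  obtain ⟨k₂, l₂, hw₂⟩ := hw'
  have hball : ∀ k l, ∀ ζ ∈ closedBall (duboisCenter x y k l) (duboisRadius x y k l),
      a ≤ ‖ζ‖ ∧ ‖ζ‖ ≤ b := fun k l ζ hζ =>
    hE ζ (by rw [hU]; exact mem_iUnion.2 ⟨k, mem_iUnion.2 ⟨l, hζ⟩⟩)
  have hdiam : ∀ k l, ∀ ζ ∈ closedBall (duboisCenter x y k l) (duboisRadius x y k l),
      ∀ ξ ∈ closedBall (duboisCenter x y k l) (duboisRadius x y k l), ‖ζ - ξ‖ ≤ b - a :=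
    fun k l ζ hζ ξ hξ =>
      norm_sub_le_of_closedBall_subset_annulus ha (duboisRadius_nonneg x y k l (hx k l)) (hball k l)
        hζ hξ
  have hρ1a := div_left_mem_closedBall x y k₁ l₁ (hx k₁ l₁)
  have hρ1b := div_left_mem_closedBall x y k₁ k₂ (hx k₁ k₂)
  have hρ2a := div_right_mem_closedBall x y k₁ k₂ (hx k₁ k₂)
  have hρ2b := div_left_mem_closedBall x y k₂ l₂ (hx k₂ l₂)
  calc ‖z - w‖ = ‖(z - y k₁ / x k₁) + (y k₁ / x k₁ - y k₂ / x k₂) + (y k₂ / x k₂ - w)‖ := by ring_nf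
    _ ≤ ‖z - y k₁ / x k₁‖ + ‖y k₁ / x k₁ - y k₂ / x k₂‖ + ‖y k₂ / x k₂ - w‖ := norm_add₃_le
    _ ≤ (b - a) + (b - a) + (b - a) :=
        add_le_add_three (hdiam k₁ l₁ _ hz₁ _ hρ1a) (hdiam k₁ k₂ _ hρ1b _ hρ2a)
          (hdiam k₂ l₂ _ hρ2b _ hw₂)
    _ = 3 * (b - a) := by ring

end Summit.CriticalPhenomena.CardyFormulaZ2.Theorems.ComplexConeContraction
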